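import Summits.AtomisticToContinuum.Crystallization.Theorems.ExcessDecayLiouvilleTaylorJumpRows

/-!
# Route `ExcessDecayLiouville`: optical consistency of the Taylor data (nonlinear half, XIV b)

Harmonic-replacement architecture for item `ExcessDecay` (stmt-AtomisticToContinuum-9334), nonlinear half.
The linear decay step produces an affine-plus-shift Taylor field `T(t m + Az) = a m + B(t m + Az − p₀)` of a
field `h` with ZERO rows near the base site `p₀ = t 0 + A z₀`, with `a 0 = h p₀` and the pointwise error
`‖h x − T x‖ ≤ K dist(x, p₀)²` on the sites of `B_{R_T}(c₀)`.  The linear regularity theory does not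
control the inter-sublattice ("optical") jump `a 0 − a 1`; the zero row of `h` at `p₀` does
(`taylor_jump_le`): splitting the row as `M(a 0 − a 1) + R(B) − Σ_q K(p₀ − q)(h − T)(q) = 0` with the cross
force-constant operator `M` (coercive, `crossFC_coercive`) and `‖R(B)‖ ≤ 38 F₇ ‖B‖`,

`‖a 0 − a 1‖ ≤ (2/κ)(38 S₇ ‖B‖ + 38 S₆ K + 38 F₈(R') Vₐ + 38 F₇(R') ‖B‖ + 38 √F₈(R') √(39 J))`,

`R' = R_T − 11/10`, `Vₐ ≥ ‖a m‖`, `J ≥` the weighted far mass of `h` with floor `R_T` about `c₀`.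
All `[folklore]`; helper lemmas, nothing here closes an item.
-/

noncomputable section

namespace Summit.AtomisticToContinuum.Crystallization.Theorems.ExcessDecayLiouville

open scoped BigOperators Topology InnerProductSpace RealInnerProductSpace Classical
open Literature.MathematicalPhysics.StatisticalMechanics
open Summit.AtomisticToContinuum.Crystallization.Theorems.PhononStabilityNegative

local notation "E3" => EuclideanSpace ℝ (Fin 3)

-- Local notation: the force-constant map `K(e)w = h(|e|²)w + 2⟪e,w⟫h′(|e|²)e` (`= forceConst e w`).
local notation3 "𝕂[" e "] " w:max =>
  (-((‖e‖ ^ 2)⁻¹) ^ 7 + ((‖e‖ ^ 2)⁻¹) ^ 4) • w + (2 * ⟪e, w⟫ * (7 * ((‖e‖ ^ 2)⁻¹) ^ 8 - 4 * ((‖e‖ ^ 2)⁻¹) ^ 5)) • e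

section

variable {t : Fin 2 → E3} {A : E3 →L[ℝ] E3} {κ : ℝ}

set_option quotPrecheck false in
-- Local notation: the operator row `(L v)(p)`.
local notation "𝕃" v:max " @ " p:max =>
  tsum (fun q : Sites₀ t A => (if ((p : Sites₀ t A) : E3) ≠ q then
    𝕂[((p : Sites₀ t A) : E3) - q] (v ((p : Sites₀ t A) : E3) - v q) else 0))
set_option quotPrecheck false in
-- Local notation: the cross force-constant operator `M = Σ'_{q ∈ S₁} K(t 0 − q)`.
local notation "𝐌ₓ" =>
  tsum (fun q : Sites₀ t A => (if (∃ z ∈ Λ₀, (q : E3) = t 1 + A z) then forceConst ((t 0 : E3) - q) else 0))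

/-! ## The jump estimate -/

/-- The error family `Z q = [p₀ ≠ q] K(p₀ − q)(h q − T q)`: pointwise bound by the near (Taylor) and far
(values, slope, far mass) families, hence the bound on `‖Σ' Z‖`. [folklore] -/
theorem taylorJump_error_row (hA : Adm₀ A) (hI : Inner₀ t A)
    {h : E3 → E3} (hh : (Function.support h).Finite) {z₀ : E3} (hz₀ : z₀ ∈ Λ₀) {c₀ : E3}
    (hp₀c : dist (t 0 + A z₀) c₀ ≤ 11 / 10)
    (a : Fin 2 → E3) (B : E3 →L[ℝ] E3) (T : E3 → E3)
    (hT : ∀ (m : Fin 2) (z : E3), z ∈ Λ₀ → T (t m + A z) = a m + B (t m + A z - (t 0 + A z₀)))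
    {K R Vₐ J : ℝ} (hK : 0 ≤ K) (hR : 3 ≤ R) (hVa : ∀ m, ‖a m‖ ≤ Vₐ)
    (htay : ∀ x ∈ Sites₀ t A, x ≠ t 0 + A z₀ → dist x c₀ ≤ R → ‖h x - T x‖ ≤ K * (dist x (t 0 + A z₀)) ^ 2)
    (hJ : ∑' q : Sites₀ t A, ‖h q‖ ^ 2 * (max (dist (q : E3) c₀) R)⁻¹ ^ 8 ≤ J) :
    ‖∑' q : Sites₀ t A, (if (t 0 + A z₀ : E3) ≠ (q : E3) then 𝕂[(t 0 + A z₀ : E3) - (q : E3)] (h q - T q) else 0)‖ ≤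
      38 * K * (1024 / ((23 / 25 : ℝ) ^ 3 * (23 / 25 : ℝ) ^ 3)) +
      (38 * Vₐ * (1024 / ((23 / 25 : ℝ) ^ 3 * (R - 11 / 10) ^ 5)) + 38 * ‖B‖ * (1024 / ((23 / 25 : ℝ) ^ 3 * (R - 11 / 10) ^ 4))) +
      38 * Real.sqrt (1024 / ((23 / 25 : ℝ) ^ 3 * (R - 11 / 10) ^ 5)) * Real.sqrt (39 * J) := by
  have hp₀ : t 0 + A z₀ ∈ Sites₀ t A := add_mem_sites₀ t0_mem_sites hz₀
  have hR' : 23 / 25 ≤ R - 11 / 10 := by linarith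
  have hVa0 : 0 ≤ Vₐ := (norm_nonneg _).trans (hVa 0)
  obtain ⟨h6s, h6le⟩ := summable_inv_pow_six_sites hA hI hp₀
  obtain ⟨hf8s, hf8le⟩ := summable_far_inv_pow_eight_sites hA hI (t 0 + A z₀) hR'
  obtain ⟨hf7s, hf7le⟩ := summable_far_inv_pow_seven_sites hA hI (t 0 + A z₀) hR'
  obtain ⟨hbhs, hbhsum⟩ := taylorJump_far_mass hA hI hh hp₀c hR hJ
  obtain ⟨bh, hbhdef⟩ : ∃ bh : Sites₀ t A → ℝ, bh = fun q : Sites₀ t A =>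
      (if R < dist (q : E3) c₀ then 38 * (dist (q : E3) (t 0 + A z₀))⁻¹ ^ 8 * ‖h q‖ else 0) := ⟨_, rfl⟩
  rw [← hbhdef] at hbhs hbhsum
  have hbh0 : ∀ q, 0 ≤ bh q := fun q => by rw [hbhdef]; simp only []; split_ifs <;> positivity
  have hZbd : ∀ q : Sites₀ t A, ‖(if (t 0 + A z₀ : E3) ≠ (q : E3) then 𝕂[(t 0 + A z₀ : E3) - (q : E3)] (h q - T q) else 0)‖ ≤
      38 * K * (if (q : E3) ≠ t 0 + A z₀ then (dist (q : E3) (t 0 + A z₀))⁻¹ ^ 6 else 0) +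
      (38 * Vₐ * (if R - 11 / 10 < dist (q : E3) (t 0 + A z₀) then (dist (q : E3) (t 0 + A z₀))⁻¹ ^ 8 else 0) +
        38 * ‖B‖ * (if R - 11 / 10 < dist (q : E3) (t 0 + A z₀) then (dist (q : E3) (t 0 + A z₀))⁻¹ ^ 7 else 0)) +
      bh q := by
    intro q
    by_cases hpq : (t 0 + A z₀ : E3) ≠ q
    · rw [if_pos hpq, if_pos (Ne.symm hpq)]
      have hd := dist_sites_ge hA hI hp₀ q.2 hpq
      rw [dist_comm] at hd
      have he : 9 / 10 ≤ ‖(t 0 + A z₀ : E3) - q‖ := by rw [← dist_eq_norm, dist_comm]; linarith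
      have hd0 : 0 < dist (q : E3) (t 0 + A z₀) := by linarith
      have hed : ‖(t 0 + A z₀ : E3) - q‖ = dist (q : E3) (t 0 + A z₀) := by rw [← dist_eq_norm, dist_comm]
      have hK1 : ‖𝕂[(t 0 + A z₀ : E3) - q] (h q - T q)‖ ≤ 38 * (dist (q : E3) (t 0 + A z₀))⁻¹ ^ 8 * ‖h q - T q‖ :=
        (norm_forceConst_apply_le he (h q - T q)).trans (le_of_eq (by rw [hed]))
      have hi0 : 0 ≤ (dist (q : E3) (t 0 + A z₀))⁻¹ := inv_nonneg.2 hd0.le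
      by_cases hnear : dist (q : E3) c₀ ≤ R
      · -- near: Taylor error
        have herr := htay q q.2 (Ne.symm hpq) hnear
        have h1 : ‖𝕂[(t 0 + A z₀ : E3) - q] (h q - T q)‖ ≤ 38 * K * (dist (q : E3) (t 0 + A z₀))⁻¹ ^ 6 := by
          refine hK1.trans ?_
          calc 38 * (dist (q : E3) (t 0 + A z₀))⁻¹ ^ 8 * ‖h q - T q‖
              ≤ 38 * (dist (q : E3) (t 0 + A z₀))⁻¹ ^ 8 * (K * dist (q : E3) (t 0 + A z₀) ^ 2) := by gcongr
            _ = 38 * K * ((dist (q : E3) (t 0 + A z₀))⁻¹ ^ 6 * ((dist (q : E3) (t 0 + A z₀))⁻¹ * dist (q : E3) (t 0 + A z₀)) ^ 2) := by ring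
            _ = 38 * K * (dist (q : E3) (t 0 + A z₀))⁻¹ ^ 6 := by rw [inv_mul_cancel₀ hd0.ne', one_pow, mul_one]
        have h2 : 0 ≤ 38 * Vₐ * (if R - 11 / 10 < dist (q : E3) (t 0 + A z₀) then (dist (q : E3) (t 0 + A z₀))⁻¹ ^ 8 else 0) +
            38 * ‖B‖ * (if R - 11 / 10 < dist (q : E3) (t 0 + A z₀) then (dist (q : E3) (t 0 + A z₀))⁻¹ ^ 7 else 0) := by
          positivity
        linarith [hbh0 q]
      · -- far
        have hfar : R < dist (q : E3) c₀ := lt_of_not_ge hnear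
        have hdf : R - 11 / 10 < dist (q : E3) (t 0 + A z₀) := by
          have := dist_triangle (q : E3) (t 0 + A z₀) c₀
          linarith
        rw [if_pos hdf, if_pos hdf, hbhdef]; simp only []; rw [if_pos hfar]
        obtain ⟨m, z, hz, hq⟩ := q.2
        have hTq : ‖T q‖ ≤ Vₐ + ‖B‖ * dist (q : E3) (t 0 + A z₀) := by
          rw [hq, hT m z hz, dist_eq_norm]
          exact (norm_add_le _ _).trans (add_le_add (hVa m) (B.le_opNorm _))
        have hsub : ‖h q - T q‖ ≤ ‖h q‖ + (Vₐ + ‖B‖ * dist (q : E3) (t 0 + A z₀)) :=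
          (norm_sub_le _ _).trans (add_le_add le_rfl hTq)
        have h6 : 0 ≤ 38 * K * (dist (q : E3) (t 0 + A z₀))⁻¹ ^ 6 := by positivity
        calc ‖𝕂[(t 0 + A z₀ : E3) - q] (h q - T q)‖
            ≤ 38 * (dist (q : E3) (t 0 + A z₀))⁻¹ ^ 8 * (‖h q‖ + (Vₐ + ‖B‖ * dist (q : E3) (t 0 + A z₀))) :=
              hK1.trans (by gcongr)
          _ = 38 * Vₐ * (dist (q : E3) (t 0 + A z₀))⁻¹ ^ 8 +
              38 * ‖B‖ * ((dist (q : E3) (t 0 + A z₀))⁻¹ ^ 7 * ((dist (q : E3) (t 0 + A z₀))⁻¹ * dist (q : E3) (t 0 + A z₀))) +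
              38 * (dist (q : E3) (t 0 + A z₀))⁻¹ ^ 8 * ‖h q‖ := by ring
          _ = 38 * Vₐ * (dist (q : E3) (t 0 + A z₀))⁻¹ ^ 8 + 38 * ‖B‖ * (dist (q : E3) (t 0 + A z₀))⁻¹ ^ 7 +
              38 * (dist (q : E3) (t 0 + A z₀))⁻¹ ^ 8 * ‖h q‖ := by rw [inv_mul_cancel₀ hd0.ne', mul_one]
          _ ≤ _ := by linarith
    · rw [if_neg hpq, norm_zero]
      have hnonneg : 0 ≤ 38 * K * (if (q : E3) ≠ t 0 + A z₀ then (dist (q : E3) (t 0 + A z₀))⁻¹ ^ 6 else 0) +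
          (38 * Vₐ * (if R - 11 / 10 < dist (q : E3) (t 0 + A z₀) then (dist (q : E3) (t 0 + A z₀))⁻¹ ^ 8 else 0) +
            38 * ‖B‖ * (if R - 11 / 10 < dist (q : E3) (t 0 + A z₀) then (dist (q : E3) (t 0 + A z₀))⁻¹ ^ 7 else 0)) := by
        positivity
      linarith [hbh0 q]
  have hbds : Summable (fun q : Sites₀ t A =>
      38 * K * (if (q : E3) ≠ t 0 + A z₀ then (dist (q : E3) (t 0 + A z₀))⁻¹ ^ 6 else 0) +
      (38 * Vₐ * (if R - 11 / 10 < dist (q : E3) (t 0 + A z₀) then (dist (q : E3) (t 0 + A z₀))⁻¹ ^ 8 else 0) +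
        38 * ‖B‖ * (if R - 11 / 10 < dist (q : E3) (t 0 + A z₀) then (dist (q : E3) (t 0 + A z₀))⁻¹ ^ 7 else 0)) +
      bh q) := (((h6s.mul_left _).add ((hf8s.mul_left _).add (hf7s.mul_left _))).add hbhs)
  have hZn : ‖∑' q : Sites₀ t A, (if (t 0 + A z₀ : E3) ≠ (q : E3) then 𝕂[(t 0 + A z₀ : E3) - (q : E3)] (h q - T q) else 0)‖ ≤ 38 * K * (1024 / ((23 / 25 : ℝ) ^ 3 * (23 / 25 : ℝ) ^ 3)) +
      (38 * Vₐ * (1024 / ((23 / 25 : ℝ) ^ 3 * (R - 11 / 10) ^ 5)) + 38 * ‖B‖ * (1024 / ((23 / 25 : ℝ) ^ 3 * (R - 11 / 10) ^ 4))) +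
      ∑' q, bh q := by
    refine (tsum_of_norm_bounded hbds.hasSum hZbd).trans ?_
    rw [((h6s.mul_left _).add ((hf8s.mul_left _).add (hf7s.mul_left _))).tsum_add hbhs,
      (h6s.mul_left _).tsum_add ((hf8s.mul_left _).add (hf7s.mul_left _)),
      (hf8s.mul_left _).tsum_add (hf7s.mul_left _), tsum_mul_left, tsum_mul_left, tsum_mul_left]
    gcongr
  exact hZn.trans (add_le_add le_rfl hbhsum)

/-- **Optical consistency of the Taylor data** (see the module docstring). [folklore] -/
theorem taylor_jump_le (hA : Adm₀ A) (hI : Inner₀ t A) (hκ0 : 0 < κ)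
    (hκ : ∀ v : E3 → E3, (Function.support v).Finite → Function.support v ⊆ Sites₀ t A →
      κ * nnForm t A v ≤ ∑' p : Sites₀ t A, ⟪𝕃 v @ p, v p⟫)
    {h : E3 → E3} (hh : (Function.support h).Finite) {z₀ : E3} (hz₀ : z₀ ∈ Λ₀) {c₀ : E3}
    (hp₀c : dist (t 0 + A z₀) c₀ ≤ 11 / 10)
    (hrow0 : 𝕃 h @ (⟨t 0 + A z₀, add_mem_sites₀ t0_mem_sites hz₀⟩ : Sites₀ t A) = 0)
    (a : Fin 2 → E3) (B : E3 →L[ℝ] E3) (T : E3 → E3)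
    (hT : ∀ (m : Fin 2) (z : E3), z ∈ Λ₀ → T (t m + A z) = a m + B (t m + A z - (t 0 + A z₀)))
    (ha0 : a 0 = h (t 0 + A z₀))
    {K R Vₐ J : ℝ} (hK : 0 ≤ K) (hR : 3 ≤ R) (hVa : ∀ m, ‖a m‖ ≤ Vₐ)
    (htay : ∀ x ∈ Sites₀ t A, x ≠ t 0 + A z₀ → dist x c₀ ≤ R → ‖h x - T x‖ ≤ K * (dist x (t 0 + A z₀)) ^ 2)
    (hJ : ∑' q : Sites₀ t A, ‖h q‖ ^ 2 * (max (dist (q : E3) c₀) R)⁻¹ ^ 8 ≤ J) :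
    ‖a 0 - a 1‖ ≤ 2 / κ * (38 * (1024 / ((23 / 25 : ℝ) ^ 3 * (23 / 25 : ℝ) ^ 4)) * ‖B‖ +
      38 * (1024 / ((23 / 25 : ℝ) ^ 3 * (23 / 25 : ℝ) ^ 3)) * K +
      38 * (1024 / ((23 / 25 : ℝ) ^ 3 * (R - 11 / 10) ^ 5)) * Vₐ +
      38 * (1024 / ((23 / 25 : ℝ) ^ 3 * (R - 11 / 10) ^ 4)) * ‖B‖ +
      38 * Real.sqrt (1024 / ((23 / 25 : ℝ) ^ 3 * (R - 11 / 10) ^ 5)) * Real.sqrt (39 * J)) := by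
  have hp₀ : t 0 + A z₀ ∈ Sites₀ t A := add_mem_sites₀ t0_mem_sites hz₀
  have hR' : 23 / 25 ≤ R - 11 / 10 := by linarith
  have hBn : 0 ≤ ‖B‖ := norm_nonneg _
  have hVa0 : 0 ≤ Vₐ := (norm_nonneg _).trans (hVa 0)
  have hJ0 : 0 ≤ J := le_trans (tsum_nonneg fun q => by positivity) hJ
  -- the four families
  obtain ⟨X, hXdef⟩ : ∃ X : Sites₀ t A → E3, X = fun q : Sites₀ t A =>
      (if (∃ z ∈ Λ₀, (q : E3) = t 1 + A z) then 𝕂[(t 0 + A z₀ : E3) - (q : E3)] (a 0 - a 1) else 0) := ⟨_, rfl⟩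
  obtain ⟨Y, hYdef⟩ : ∃ Y : Sites₀ t A → E3, Y = fun q : Sites₀ t A =>
      (if (t 0 + A z₀ : E3) ≠ (q : E3) then 𝕂[(t 0 + A z₀ : E3) - (q : E3)] (B ((t 0 + A z₀ : E3) - (q : E3))) else 0) := ⟨_, rfl⟩
  obtain ⟨Z, hZdef⟩ : ∃ Z : Sites₀ t A → E3, Z = fun q : Sites₀ t A =>
      (if (t 0 + A z₀ : E3) ≠ (q : E3) then 𝕂[(t 0 + A z₀ : E3) - (q : E3)] (h q - T q) else 0) := ⟨_, rfl⟩
  obtain ⟨W, hWdef⟩ : ∃ W : Sites₀ t A → E3, W = fun q : Sites₀ t A =>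
      (if (t 0 + A z₀ : E3) ≠ (q : E3) then 𝕂[(t 0 + A z₀ : E3) - (q : E3)] (h (t 0 + A z₀) - h q) else 0) := ⟨_, rfl⟩
  -- (A) pointwise decomposition of the row of h
  have hdec : ∀ q : Sites₀ t A, W q = X q + Y q - Z q := by
    intro q
    obtain ⟨m, z, hz, hq⟩ := q.2
    by_cases hpq : (t 0 + A z₀ : E3) = q
    · -- q = p₀
      have hX0 : X q = 0 := by
        rw [hXdef]; simp only []
        rw [if_neg]
        rintro ⟨z', hz', hq'⟩
        exact sublattice_ne hA hI hz₀ hz' (hpq.trans hq')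
      rw [hWdef, hYdef, hZdef, hX0]; simp only []
      rw [if_neg (not_not.2 hpq), if_neg (not_not.2 hpq), if_neg (not_not.2 hpq)]; simp
    · have hTq : T q = a m + B ((q : E3) - (t 0 + A z₀)) := by rw [hq]; exact hT m z hz
      have hkey : h (t 0 + A z₀) - h q = (a 0 - a m) + B ((t 0 + A z₀ : E3) - q) - (h q - T q) := by
        rw [hTq, ← ha0, map_sub, map_sub]; abel
      have hXq : X q = 𝕂[(t 0 + A z₀ : E3) - q] (a 0 - a m) := by
        rw [hXdef]; simp only []
        obtain hm | hm : m = 0 ∨ m = 1 := by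
          rcases m with ⟨_ | _ | n, hn⟩
          · exact Or.inl rfl
          · exact Or.inr rfl
          · omega
        · subst hm
          rw [if_neg]
          · simp
          · rintro ⟨z', hz', hq'⟩
            exact sublattice_ne hA hI hz hz' (hq.symm.trans hq')
        · subst hm
          rw [if_pos ⟨z, hz, hq⟩]
      rw [hWdef, hYdef, hZdef, hXq]; simp only []
      rw [if_pos hpq, if_pos hpq, if_pos hpq, hkey, forceConst_sub_right, forceConst_add_right]
  -- (B) summability
  have hWs : Summable W := by rw [hWdef]; exact summable_opRow hA hI hh ⟨_, hp₀⟩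
  have hXs : Summable X := by rw [hXdef]; exact summable_crossRow hA hI ⟨_, hp₀⟩ (a 0 - a 1)
  obtain ⟨hYs, hYn⟩ := taylorJump_linear_row hA hI hz₀ B
  rw [← hYdef] at hYs hYn
  have hZeq : Z = fun q => X q + Y q - W q := by funext q; rw [hdec q]; abel
  have hZs : Summable Z := by rw [hZeq]; exact (hXs.add hYs).sub hWs
  -- (C) the identity M(a 0 − a 1) = Σ'Z − Σ'Y
  have hW0 : ∑' q, W q = 0 := by rw [hWdef]; exact hrow0
  have hXsum : ∑' q, X q = (𝐌ₓ) (a 0 - a 1) := by rw [hXdef]; exact crossRow_eq hA hI (a 0 - a 1) hz₀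
  have hMeq : (𝐌ₓ) (a 0 - a 1) = ∑' q, Z q - ∑' q, Y q := by
    rw [← hXsum]
    have : ∑' q, W q = ∑' q, X q + ∑' q, Y q - ∑' q, Z q := by
      rw [← hXs.tsum_add hYs, ← (hXs.add hYs).tsum_sub hZs]
      exact tsum_congr hdec
    rw [hW0] at this
    have h' : ∑' q, X q + ∑' q, Y q - ∑' q, Z q = 0 := this.symm
    calc ∑' q, X q = (∑' q, X q + ∑' q, Y q - ∑' q, Z q) + (∑' q, Z q - ∑' q, Y q) := by abel
      _ = _ := by rw [h', zero_add]
  -- (D) the two row bounds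
  have hZn := taylorJump_error_row hA hI hh hz₀ hp₀c a B T hT hK hR hVa htay hJ
  rw [← hZdef] at hZn
  -- (E) coercivity (the vector `M(a 0 − a 1)` is named to keep elaboration cheap)
  obtain ⟨μ, hμ⟩ : ∃ μ : E3, μ = (𝐌ₓ) (a 0 - a 1) := ⟨_, rfl⟩
  have hμeq : μ = ∑' q, Z q - ∑' q, Y q := hμ.trans hMeq
  have hM : ‖μ‖ ≤ 38 * (1024 / ((23 / 25 : ℝ) ^ 3 * (23 / 25 : ℝ) ^ 4)) * ‖B‖ +
      38 * (1024 / ((23 / 25 : ℝ) ^ 3 * (23 / 25 : ℝ) ^ 3)) * K +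
      38 * (1024 / ((23 / 25 : ℝ) ^ 3 * (R - 11 / 10) ^ 5)) * Vₐ +
      38 * (1024 / ((23 / 25 : ℝ) ^ 3 * (R - 11 / 10) ^ 4)) * ‖B‖ +
      38 * Real.sqrt (1024 / ((23 / 25 : ℝ) ^ 3 * (R - 11 / 10) ^ 5)) * Real.sqrt (39 * J) := by
    rw [hμeq]
    refine (norm_sub_le _ _).trans ?_
    refine (add_le_add hZn hYn).trans (le_of_eq ?_)
    ring
  have hcoer : κ / 2 * ‖a 0 - a 1‖ ^ 2 ≤ ⟪μ, a 0 - a 1⟫ := by rw [hμ]; exact crossFC_coercive hA hI hκ0 hκ (a 0 - a 1)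
  have hCS : ⟪μ, a 0 - a 1⟫ ≤ ‖μ‖ * ‖a 0 - a 1‖ := real_inner_le_norm _ _
  have hn0 : 0 ≤ ‖a 0 - a 1‖ := norm_nonneg _
  have hRHS : 0 ≤ 2 / κ * (38 * (1024 / ((23 / 25 : ℝ) ^ 3 * (23 / 25 : ℝ) ^ 4)) * ‖B‖ +
      38 * (1024 / ((23 / 25 : ℝ) ^ 3 * (23 / 25 : ℝ) ^ 3)) * K +
      38 * (1024 / ((23 / 25 : ℝ) ^ 3 * (R - 11 / 10) ^ 5)) * Vₐ +
      38 * (1024 / ((23 / 25 : ℝ) ^ 3 * (R - 11 / 10) ^ 4)) * ‖B‖ +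
      38 * Real.sqrt (1024 / ((23 / 25 : ℝ) ^ 3 * (R - 11 / 10) ^ 5)) * Real.sqrt (39 * J)) := by
    have : 0 < R - 11 / 10 := by linarith
    positivity
  by_cases hz : ‖a 0 - a 1‖ = 0
  · rw [hz]; exact hRHS
  · have hpos : 0 < ‖a 0 - a 1‖ := lt_of_le_of_ne hn0 (Ne.symm hz)
    have h2 : κ / 2 * ‖a 0 - a 1‖ * ‖a 0 - a 1‖ ≤ ‖μ‖ * ‖a 0 - a 1‖ := by
      rw [mul_assoc, ← pow_two]; exact hcoer.trans hCS
    have h1 : κ / 2 * ‖a 0 - a 1‖ ≤ ‖μ‖ := le_of_mul_le_mul_right h2 hpos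
    have hκ2 : 2 / κ * (κ / 2) = 1 := by field_simp
    calc ‖a 0 - a 1‖ = (2 / κ * (κ / 2)) * ‖a 0 - a 1‖ := by rw [hκ2, one_mul]
      _ = 2 / κ * (κ / 2 * ‖a 0 - a 1‖) := by ring
      _ ≤ 2 / κ * ‖μ‖ := by gcongr
      _ ≤ _ := by gcongr

end

end Summit.AtomisticToContinuum.Crystallization.Theorems.ExcessDecayLiouville

end
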